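import Summits.BirchSwinnertonDyer.Rank1Residual.Additive.TwistPartnerForcedTower
import Summits.BirchSwinnertonDyer.Rank1Residual.Additive.TwistPartnerForcedCertificateBound
import Summits.BirchSwinnertonDyer.Rank1Residual.Additive.PlusSymbolsPIntegralOfIrreducible
import HarnessLib

/-!
# The per-pair JOIN on defect 3, 4, 6 with TOWER inputs only: forced partner bounded on the
# `p`-power tower + tower bound `p^c` of the plus symbols + ONE Riemann sum attaining `p^c` ⟹ the
# λ-certificate and Schneider at `r_an = 1`; class forms on X3♯(G-ord) / X4♯(G-ord)
# (cell `b2b-bsdres`, sub-cell additive-p2, gen 24; sequel of `TwistPartnerForcedTower.lean`,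
# `TwistPartnerForcedCertificateBound.lean`, `TwistPartnerForcedCertificateClassX4.lean`)

HONEST FRAMING (cell `b2b-bsdres`, run/shared/lean/b2b/bsd-rank1-residual/, verbatim in every
file): the goal of the cell is to DELETE the COMBINATION-SHAPED residual classes of the
Birch–Swinnerton-Dyer formula for ALL analytic-rank `≤ 1` elliptic curves over `ℚ` — "full BSD
formula for every rank `≤ 1` curve in class `C`" assembled STRICTLY from published theorems — so
that the rank-`≤ 1` remainder becomes exactly the CONSTRUCTION-SHAPED classes, which are TYPED
(missing-input `Prop`s), NOT attempted. This is not "finishing BSD". Sub-cell additive-p2: the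
classes X3♯(G-ord) / X4♯(G-ord) are CONSTRUCTION-SHAPED and stay so; labels / RESIDUAL-MAP marks
UNCHANGED; nothing is booked. THEOREMS ONLY (no definition, no named fact, no conjecture node); the
typed Kato half / Delbourgo 2002 (A), (A_M), (C) (A175, A227), GZK, the tower boundedness of the
forced partner, the tower bound `p^c` and the finite equality `‖RS k n‖ = p^c` are explicit
hypotheses (referee-1 rule R1); instrument output (gen 23 §3–§4, gen 24 E-FORCED-4/5/6) is EVIDENCE.

## What

The FINAL per-pair shape of the tame-branch rank-one package on the defect-3/4/6 rows, every input
a statement about the numbers the census engines compute (values of `E`'s plus symbol and of the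
forced partner at the points `a/pⁿ`): on the X4-3 locus (`p ≥ 5`, `E = W` additive at `p`, `SubGord`,
`e ∈ {3,4,6}`), `f` a newform of `E`, `χ = ω^{t(E,p)}`, `ã` a unit,
* `charLamLeAt_of_tameBranchRatDvdAt_of_towerForcedRiemannSum` — typed Kato half + forced partner
  bounded ON THE TOWER + `∀ n a, ‖[a/pⁿ]⁺_f‖_p ≤ p^c` + `‖RS k n‖_p = p^c` (`k < p`, `n ≥ 1`) ⟹
  `CharLamLeAt W p k`;
* `exists_schneider_rankOne_of_tameBranchRatDvdAt_of_towerForcedRiemannSum` — at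
  `ord_{s=1}L(E,s) = 1`, non-CM, with A175 and GZK: Schneider for every (B)-datum, one exists;
* `ClassX3Gord.exists_schneider_rankOne_of_thmC_of_towerForcedRiemannSum` (typed Kato half
  discharged by Delbourgo 2002 (C); the tower bound `p^c` a per-pair input, `c ≥ 1` possible) and
  `ClassX4Gord.exists_schneider_rankOne_of_thmC_of_towerForcedRiemannSum` (`c = 0` by
  `plusSymbolsPIntegralAt_of_classX4`: printed facts + tower boundedness + ONE unit sum).
Nothing booked.

References: D. Delbourgo, J. Number Theory 95 (2002) Thm. (A)–(C) p. 40 [Delbourgo2002]; B. Mazur,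
J. Tate, J. Teitelbaum, Invent. Math. 84 (1986) §I.10–I.14 [MazurTateTeitelbaum1986Invent]; W. Stein,
C. Wuthrich, Math. Comp. 82 (2013) §3 [SteinWuthrich2013]; L. Washington, GTM 83 §7.1 [Washington1997];
Ju. I. Manin, Izv. 36 (1972) Cor. 3.6 [Manin1972].
-/

noncomputable section

open scoped Classical MatrixGroups ModularForm NumberField

open CongruenceSubgroup WeierstrassCurve NumberField Literature.NumberTheory.EllipticCurves
  Literature.NumberTheory.EllipticCurves.ModularForms
  Literature.NumberTheory.EllipticCurves.Rank1Residual
  Literature.NumberTheory.EllipticCurves.Rank1Residual.Typed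
  Literature.NumberTheory.EllipticCurves.Delbourgo2002
  Summit.BirchSwinnertonDyer.Rank1Residual.X1.MuLambda
  Summit.BirchSwinnertonDyer.Rank1Residual.X11a.LambdaNorm

namespace Summit.BirchSwinnertonDyer.Rank1Residual.Additive

section TowerJoin

variable {W : WeierstrassCurve ℚ} [W.IsElliptic] [W.IsGloballyMinimal] {p : ℕ} [hp : Fact p.Prime]
  {N : ℕ} [NeZero N] {f : CuspForm (Gamma0 N) 2} {χ : MulChar (ZMod p) ℚ_[p]} {ã : ℚ_[p]}
  {RS : ℕ → ℕ → ℚ_[p]}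
  (hRS : ∀ k n : ℕ, RS k n =
      ∑ᶠ ξ : rootsOfUnity (Literature.NumberTheory.EllipticCurves.torsionOrder p) ℤ_[p],
        ∑ s : ZMod (p ^ n),
        twistPartnerMeasure χ
            (TwistPartner.forced χ (fun r ↦ ((ratPlusSymbol f r : ℚ) : ℚ_[p])) ã) ã
            ((ratPlusSymbol f 0 : ℚ) : ℚ_[p]) (n + cyclotomicExponent p)
            (PadicInt.toZModPow (n + cyclotomicExponent p) ((ξ : ℤ_[p]ˣ) : ℤ_[p]) *
              (cyclotomicGenerator p : ZMod (p ^ (n + cyclotomicExponent p))) ^ s.val) *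
          ((s.val.choose k : ℕ) : ℚ_[p]))

include hRS

/-- **THE JOIN, tower inputs.** On the X4-3 locus, for a newform `f` of `E = W`, `χ = ω^{t(E,p)}` and a
unit `ã`: typed Kato half + the forced partner bounded ON THE TOWER + the tower bound
`‖[a/pⁿ]⁺_f‖_p ≤ p^c` + `‖RS k n‖_p = p^c` (`k < p`, `n ≥ 1`) ⟹ `CharLamLeAt W p k`.
[cite: Delbourgo2002, Theorem (C) (p. 40)] [cite: Washington1997, §7.1] [cite: SteinWuthrich2013, §3] -/
theorem charLamLeAt_of_tameBranchRatDvdAt_of_towerForcedRiemannSum (hT : TameBranchRatDvdAt W p)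
    (h5 : 5 ≤ p) (hadd : Addv W p) (hG : SubGord W p)
    (he : semistabilityIndex W p ∈ ({3, 4, 6} : Finset ℕ)) (hf : IsNewformOf W f)
    (hχ : CensusX43.IsTeichmullerPow χ (CensusX43.ordinaryTeichmullerExponent W p)) (hã : ‖ã‖ = 1)
    {C₀ : ℝ}
    (hC₀ : ∀ (n : ℕ) (a : ℤ),
      ‖TwistPartner.forced χ (fun r ↦ ((ratPlusSymbol f r : ℚ) : ℚ_[p])) ã ((a : ℚ) / (p : ℚ) ^ n)‖ ≤ C₀)
    {c : ℕ}
    (hc : ∀ (n : ℕ) (a : ℤ), ‖((ratPlusSymbol f ((a : ℚ) / (p : ℚ) ^ n) : ℚ) : ℚ_[p])‖ ≤ (p : ℝ) ^ c)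
    {k n : ℕ} (hk : k < p) (hn : 1 ≤ n) (heq : ‖RS k n‖ = (p : ℝ) ^ c) : CharLamLeAt W p k := by
  have hne : χ ≠ 1 := CensusX43.ne_one_of_isTeichmullerPow hχ
    (CensusX43.not_dvd_ordinaryTeichmullerExponent W p h5 he hG.2.2)
  have hU0 := sum_ratPlusSymbol_add_div_eq_zero_of_addv W hf hadd
  obtain ⟨B, hB, hint, -⟩ :=
    exists_isTameBranchOf_riemannSum_of_towerBounded_forced hRS hne hã hU0 hC₀
  have hord : orderOf (χ.ringHomComp (algebraMap ℚ_[p] ℂ_[p])) = tameDefect W p := by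
    rw [orderOf_ringHomComp_padicComplex, orderOf_eq_of_isTeichmullerPow hχ,
      div_gcd_ordinaryTeichmullerExponent_eq W p he hG.2.2, tameDefect_of_not_potMult W p hG.1]
  have hp2 : p ≠ 2 := by omega
  have hne2 : semistabilityIndex W p ≠ 2 := by
    simp only [Finset.mem_insert, Finset.mem_singleton] at he
    omega
  have hGord : TypeGOrd W p :=
    (typeGOrd_iff_typeG_of_semistabilityIndex_ne_two W p h5 hadd hne2).mpr
      ((subGord_iff_typeG_of_addv W p hp2 hadd).mp hG)
  have hbd : ∀ j : ℕ, ‖PowerSeries.coeff j B‖ ≤ (p : ℝ) ^ c := hint _ hc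
  have hk' : ‖PowerSeries.coeff k B‖ = (p : ℝ) ^ c :=
    hB.norm_coeff_eq_pow_of_forcedRiemannSum_tower hRS hne hã hU0 hC₀ hc hk hn heq
  exact charLamLeAt_of_tameBranchRatDvdAt_of_norm_le_pow_of_norm_coeff_eq_pow hT hp2 hadd (Or.inr hGord)
    hf hord hã hB hbd hk'

/-- **X4-3 locus, `ord_{s=1}L(E,s) = 1`, non-CM: Schneider for Delbourgo's datum, tower inputs**
(typed Kato half; A175; GZK; forced partner bounded on the tower; tower bound `p^c`; `‖RS 1 n‖ = p^c`,
`n ≥ 1`). [cite: Delbourgo2002, Theorem (A), (B), (C) (p. 40)] [cite: SteinWuthrich2013, §3] -/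
theorem exists_schneider_rankOne_of_tameBranchRatDvdAt_of_towerForcedRiemannSum
    (hDel : Delbourgo2002.mainTheorem) (hGZK : rank_eq_analyticRank_of_analyticRank_le_one)
    (hT : TameBranchRatDvdAt W p) (h5 : 5 ≤ p) (hcm : ¬ W.HasCM) (hadd : Addv W p) (hG : SubGord W p)
    (he : semistabilityIndex W p ∈ ({3, 4, 6} : Finset ℕ)) (hr : W.analyticRank = 1)
    (hf : IsNewformOf W f)
    (hχ : CensusX43.IsTeichmullerPow χ (CensusX43.ordinaryTeichmullerExponent W p)) (hã : ‖ã‖ = 1)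
    {C₀ : ℝ}
    (hC₀ : ∀ (n : ℕ) (a : ℤ),
      ‖TwistPartner.forced χ (fun r ↦ ((ratPlusSymbol f r : ℚ) : ℚ_[p])) ã ((a : ℚ) / (p : ℚ) ^ n)‖ ≤ C₀)
    {c : ℕ}
    (hc : ∀ (n : ℕ) (a : ℤ), ‖((ratPlusSymbol f ((a : ℚ) / (p : ℚ) ^ n) : ℚ) : ℚ_[p])‖ ≤ (p : ℝ) ^ c)
    {n : ℕ} (hn : 1 ≤ n) (heq : ‖RS 1 n‖ = (p : ℝ) ^ c) :
    (∀ Dh : PAdicHeightData W p, LeadingTermClauses W p Dh → SchneiderConjecture Dh) ∧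
      ∃ Dh : PAdicHeightData W p, LeadingTermClauses W p Dh ∧ SchneiderConjecture Dh := by
  have hp2 : p ≠ 2 := by omega
  have hne2 : semistabilityIndex W p ≠ 2 := by
    simp only [Finset.mem_insert, Finset.mem_singleton] at he
    omega
  have hGord : TypeGOrd W p :=
    (typeGOrd_iff_typeG_of_semistabilityIndex_ne_two W p h5 hadd hne2).mpr
      ((subGord_iff_typeG_of_addv W p hp2 hadd).mp hG)
  obtain ⟨hmw, -⟩ := hGZK W (by rw [hr])
  have hr1 : W.mordellWeilRank = 1 := by rw [hmw, hr]
  have hlam : CharLamLeAt W p W.mordellWeilRank := by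
    rw [hr1]
    exact charLamLeAt_of_tameBranchRatDvdAt_of_towerForcedRiemannSum hRS hT h5 hadd hG he hf hχ hã hC₀
      hc (by omega) hn heq
  have hA : ∀ (κ : ZpExtension ℚ p) (γ : Field.absoluteGaloisGroup ℚ),
      κ.IsCyclotomic → κ.IsTopGenerator γ → ∀ D : W.SelmerDualData κ γ, D.IsTorsion :=
    fun _ _ hκ hγ D ↦ Delbourgo2002.mainTheorem.isTorsion hDel h5 hcm hadd hGord hκ hγ D
  have hS : ∀ Dh : PAdicHeightData W p, LeadingTermClauses W p Dh → SchneiderConjecture Dh :=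
    fun Dh hBcl ↦ (schneider_and_finite_of_charLamLe W p hBcl hA hlam).1
  obtain ⟨Dh, hBcl⟩ := Delbourgo2002.mainTheorem.exists_leadingTermClauses hDel h5 hcm hadd hGord
  exact ⟨hS, Dh, hBcl, hS Dh hBcl⟩

/-- **X3♯(G-ord), defect 3, 4, 6, `ord_{s=1}L(E,s) = 1`, `p ≥ 5`, non-CM — Schneider for Delbourgo's
datum from PRINTED facts (Delbourgo 2002 (A), (B), (C); GZK) and THREE per-pair statements about
the values of `E`'s plus symbol and of the forced partner on the `p`-power tower: tower
boundedness of the forced partner (all levels), the tower bound `p^c` of `[a/pⁿ]⁺_f`, and ONE Riemann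
sum with `‖RS 1 n‖_p = p^c`.** Nothing booked; X3♯(G-ord) CONSTRUCTION-SHAPED.
[cite: Delbourgo2002, Theorem (A), (B), (C) (p. 40)] [cite: Manin1972, Cor. 3.6] [cite: SteinWuthrich2013, §3] -/
theorem ClassX3Gord.exists_schneider_rankOne_of_thmC_of_towerForcedRiemannSum
    (hC : Delbourgo2002.thmC_charIdeal_dvd_tameBranch) (hDel : Delbourgo2002.mainTheorem)
    (hDelM : Delbourgo2002.mainTheorem_potMult) (hGZK : rank_eq_analyticRank_of_analyticRank_le_one)
    (hX : ClassX3Gord W p) (h5 : 5 ≤ p) (hcm : ¬ W.HasCM)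
    (he : semistabilityIndex W p ∈ ({3, 4, 6} : Finset ℕ)) (hr : W.analyticRank = 1)
    (hf : IsNewformOf W f)
    (hχ : CensusX43.IsTeichmullerPow χ (CensusX43.ordinaryTeichmullerExponent W p)) (hã : ‖ã‖ = 1)
    {C₀ : ℝ}
    (hC₀ : ∀ (n : ℕ) (a : ℤ),
      ‖TwistPartner.forced χ (fun r ↦ ((ratPlusSymbol f r : ℚ) : ℚ_[p])) ã ((a : ℚ) / (p : ℚ) ^ n)‖ ≤ C₀)
    {c : ℕ}
    (hc : ∀ (n : ℕ) (a : ℤ), ‖((ratPlusSymbol f ((a : ℚ) / (p : ℚ) ^ n) : ℚ) : ℚ_[p])‖ ≤ (p : ℝ) ^ c)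
    {n : ℕ} (hn : 1 ≤ n) (heq : ‖RS 1 n‖ = (p : ℝ) ^ c) :
    (∀ Dh : PAdicHeightData W p, LeadingTermClauses W p Dh → SchneiderConjecture Dh) ∧
      ∃ Dh : PAdicHeightData W p, LeadingTermClauses W p Dh ∧ SchneiderConjecture Dh :=
  have hadd : Addv W p := hX.addv
  have hG : SubGord W p := (subGord_iff_typeG_of_addv W p (by omega) hadd).mpr hX.typeGOrd.typeG
  Additive.exists_schneider_rankOne_of_tameBranchRatDvdAt_of_towerForcedRiemannSum hRS hDel hGZK
    (tameBranchRatDvdAt_of_thmC hC hDel hDelM h5 hcm) h5 hcm hadd hG he hr hf hχ hã hC₀ hc hn heq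

/-- **X4♯(G-ord), defect 3, 4, 6, `ord_{s=1}L(E,s) = 1`, `p ≥ 5`, non-CM — Schneider for Delbourgo's
datum from PRINTED facts (Delbourgo 2002 (A), (B), (C); GZK; Drinfeld–Manin integrality on X4,
`plusSymbolsPIntegralAt_of_classX4`) and TWO per-pair statements about tower values: tower
boundedness of the forced partner and ONE unit Riemann sum `‖RS 1 n‖_p = 1`.** The sharpest form of
this sub-cell's rank-one residue on X4♯(G-ord) ∩ {e ∈ {3,4,6}}. Nothing booked.
[cite: Delbourgo2002, Theorem (A), (B), (C) (p. 40)] [cite: Manin1972, Cor. 3.6] [cite: SteinWuthrich2013, §3] -/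
theorem ClassX4Gord.exists_schneider_rankOne_of_thmC_of_towerForcedRiemannSum
    (hC : Delbourgo2002.thmC_charIdeal_dvd_tameBranch) (hDel : Delbourgo2002.mainTheorem)
    (hDelM : Delbourgo2002.mainTheorem_potMult) (hGZK : rank_eq_analyticRank_of_analyticRank_le_one)
    (hX : ClassX4Gord W p) (h5 : 5 ≤ p) (hcm : ¬ W.HasCM)
    (he : semistabilityIndex W p ∈ ({3, 4, 6} : Finset ℕ)) (hr : W.analyticRank = 1)
    (hf : IsNewformOf W f)
    (hχ : CensusX43.IsTeichmullerPow χ (CensusX43.ordinaryTeichmullerExponent W p)) (hã : ‖ã‖ = 1)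
    {C₀ : ℝ}
    (hC₀ : ∀ (n : ℕ) (a : ℤ),
      ‖TwistPartner.forced χ (fun r ↦ ((ratPlusSymbol f r : ℚ) : ℚ_[p])) ã ((a : ℚ) / (p : ℚ) ^ n)‖ ≤ C₀)
    {n : ℕ} (hn : 1 ≤ n) (hunit : ‖RS 1 n‖ = 1) :
    (∀ Dh : PAdicHeightData W p, LeadingTermClauses W p Dh → SchneiderConjecture Dh) ∧
      ∃ Dh : PAdicHeightData W p, LeadingTermClauses W p Dh ∧ SchneiderConjecture Dh :=
  have hadd : Addv W p := hX.addv.2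
  have hG : SubGord W p := (subGord_iff_typeG_of_addv W p (by omega) hadd).mpr hX.typeGOrd.typeG
  have hc : ∀ (m : ℕ) (a : ℤ),
      ‖((ratPlusSymbol f ((a : ℚ) / (p : ℚ) ^ m) : ℚ) : ℚ_[p])‖ ≤ (p : ℝ) ^ (0 : ℕ) := fun m a ↦ by
    rw [pow_zero]
    exact plusSymbolsPIntegralAt_of_classX4 W p hX.1 f hf _
  Additive.exists_schneider_rankOne_of_tameBranchRatDvdAt_of_towerForcedRiemannSum hRS hDel hGZK
    (tameBranchRatDvdAt_of_thmC hC hDel hDelM h5 hcm) h5 hcm hadd hG he hr hf hχ hã hC₀ hc hn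
    (by rw [pow_zero]; exact hunit)

end TowerJoin

end Summit.BirchSwinnertonDyer.Rank1Residual.Additive

end
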